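import Literature.NumberTheory.Automorphic.ArchEndoscopicChartOrbUnfoldSplit      -- ★ p850514 (this seat): (M1b′) `exists_leafMeasure_archRH_mul_chartOrbH_eq_of_isHaarMeasure` (uniform unfolding + uniformly proper leaf)
import Literature.NumberTheory.Rogawski1990.ArchBouazizSmoothBoundedSlab           -- ★ p850118 (LH3-p01 (g3)): the slab reduction `archBzSmoothBounded_stOrbFamH_of_slab_zero` (its `h1` is this file's head); brings ★ `stOrbFamH`
import Literature.NumberTheory.Automorphic.ArchEndoscopicChartOrbitalSmooth        -- ★ p849959 (LH3-p01 (g3)): `contDiff_coe_endoEmbArch_endoTorus`, `contDiff_flipSet`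
import Literature.NumberTheory.Rogawski1990.ArchBouazizStableFamilyCayleyValue     -- ★ p850153 (LH5-p04 (g2)): `stOrbFamH_eq_of_tendsto` (the wall value is the limit from `RegS`)
import Literature.NumberTheory.Automorphic.ArchCartanRegularDense                  -- ★ p849809 (LH3-p01 (g3)): `mem_closure_regS`
import Literature.NumberTheory.Automorphic.ArchLocalTorusOrbitalBlockSmooth        -- ★ Hörmander engine `Literature.Analysis.Calculus.contDiffAt_integral_comp_of_contDiff_of_support`
import Literature.NumberTheory.Rogawski1990.ArchSmoothAmbientLift                  -- ★ `ArchSmooth₂.exists_contDiff` (ambient smooth `Θ` on `M₃(L ⊗ ℝ)`)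
import HarnessLib

/-!
# [C1b] HARISH-CHANDRA SMOOTHNESS ACROSS THE SPLIT WALLS: the normalised stable orbital family `stOrbFamH L νH fH S` of every `fH ∈ C_c^∞(H_∞)` is `C^∞` on the
# fundamental slab `{0 < θ_{w,0} − θ_{w,2} < 2π, w ∉ S}` — INCLUDING the real walls `x_w = 0`, `w ∈ S` (the `h1` of ★ `archBzSmoothBounded_stOrbFamH_of_slab_zero`)
# (Varadarajan 1989 §6.4 Thm 23; Shelstad 1979 §4 Lemma 4.3; Bouaziz 1994 §3.1 (I₁); Rogawski 1990 §8.2)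

Topic `NumberTheory/Rogawski1990`; namespace `Literature.NumberTheory.Rogawski1990`.  THEOREMS ONLY (no `def`, no instance, no axiom, no `sorry`).  Cell `pub/hodgecm-mathlib`,
crux H413 (`stmt-HodgeConjecture-24833`), line LH3 (closer stub `stub_N9`, DIRECT ROAD), organ O-L3′ (letter `BouazizSurjectiveStatement`, conjunct (ii) «`stOrbFamH` of every
`ArchSmooth₂ fH` lies in `ArchBouazizSpaceH jcH`»), clause (SB-H) [C1] = [C1b] (LH3-plan (g3) RULINGS #7 (d), 2026-09-02).  Author LH3-p01 (g4).  Count-neutral until the letter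
closes; this is the (I₁)-half of its membership conjunct for GENERAL `fH` (the product case is not enough: (SB-H) quantifies over all `fH`).

THE MATHEMATICS.  By ★ (M1b′) `exists_leafMeasure_archRH_mul_chartOrbH_eq_of_isHaarMeasure`, on the regular set `RegS S`
  `R_S(c) · chartOrbH νH S fH c = K₀ · E_S(c) · I(c)`,  `I(c) = ∫_{A×A} fH((z₁,1)·(γ_S(c)·(z₂,1))·(z₁,1)⁻¹) dΛ(z)`,  `E_S(c) = Π_{w∈S} e^{x_w} · Π_{w∉S} (1 − e^{i(θ_{w,2}−θ_{w,0})})`,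
with `Λ` a FIXED measure carried by a closed leaf `Z` which is UNIFORMLY PROPER over compacts of coordinates regular at the compact places.  (§1–§2) Hence `I` is `C^∞` on Bouaziz's
in-regular set `InRegS S` (all `x_w` allowed): near `c₀ ∈ InRegS S` the integrand reads `Θ(P₁ · ι(γ_S(c)) · P₂ · P₃)` for the ambient smooth `Θ` of `fH` (★ `ArchSmooth₂.exists_contDiff`) and
the continuous leaf datum `P(z) = (ι(z₁,1), ι(z₂,1), ι(z₁,1)⁻¹)`, and it vanishes off ONE compact of the leaf for `c` in a compact neighbourhood of `c₀` (properness) — Hörmander's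
differentiation under the integral sign (★ engine, run on the closed leaf through `Measure.comap Subtype.val`).  (§3) On `RegS S` the literal reading ★ `stOrbFamH_of_mem_regS`
`= R_S(c) · Σ_T chartOrbH(flipSet T c)` becomes, since the flips `T ⊆ Sᶜ` do not touch the split slots and the compact-place factors of `R_S` and `E_S` coincide and do not vanish
on `InRegS S`, `stOrbFamH = G := K₀ · E_S · Σ_T I ∘ flipSet T` — and `G` is `C^∞` on `InRegS S`.  (§4) At a real wall point of the slab (`x_w = 0` for some `w ∈ S`; off `RegS S`, in
`InRegS S`, in the closure of `RegS S` ★ `mem_closure_regS`) the family is by DEFINITION the limit from `RegS S` (★ `stOrbFamH_eq_of_tendsto`), which is `G(c₀)` by continuity of `G`: so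
`stOrbFamH = G` on the whole slab and **`contDiffOn_stOrbFamH_slab_zero`** follows — Harish-Chandra's theorem that `F_f^A` is smooth through the singular set of the split Cartan,
for `U(1,1)^{[L⁺:ℚ]} × U(1)^{[L⁺:ℚ]}`, simultaneously in all places.
HONEST LABEL: HC_CM is proved only modulo the 7 printed citations (2 remaining: hLiu418 = stmt-HodgeConjecture-24832, h413 = stmt-HodgeConjecture-24833) until rung 0 closes; this file
pays the (I₁)-on-the-slab half of (SB-H) for general `fH`; the bounded one-sided jets `h2` (Bouaziz (I₂)) and the surjectivity half of L3′ remain.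

## References
* [Varadarajan1989] V. S. Varadarajan, *An Introduction to Harmonic Analysis on Semisimple Lie Groups*, Cambridge Stud. Adv. Math. 16 (1989), §6.4 Lemma 21, Thm 23 (`F_f^A` is smooth on `A`).
* [Shelstad1979] D. Shelstad, *Characters and inner forms of a quasi-split group over ℝ*, Compositio Math. 39 (1979), §4 pp. 22–25, Lemma 4.3.
* [Bouaziz1994IntegralesOrbitales] A. Bouaziz, *Intégrales orbitales sur les algèbres de Lie réductives*, Invent. Math. 115 (1994), §3.1 (I₁) p. 579; §6.2 p. 591.
* [Rogawski1990] J. D. Rogawski, *Automorphic Representations of Unitary Groups in Three Variables*, Ann. of Math. Stud. 123 (1990), §8.2 pp. 119–122, §8.3.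
* [HormanderALPDO1] L. Hörmander, *The Analysis of Linear Partial Differential Operators I* (1990), Thm. 1.1.9.
-/

set_option autoImplicit false

noncomputable section

open MeasureTheory Measure Filter Topology Set Function NumberField NumberField.InfinitePlace NumberField.mixedEmbedding Matrix Complex
open Literature.NumberTheory.Automorphic Literature.NumberTheory.Automorphic.UnitaryGroup Literature.NumberTheory.Automorphic.ArchCartan
open scoped ContDiff Classical MatrixGroups Matrix ENNReal NNReal
open scoped Matrix.Norms.Operator

namespace Literature.NumberTheory.Rogawski1990

/-! ## §1 Differentiation under the integral sign on a closed leaf carrying the measure -/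

section Leaf

variable {Y : Type*} [TopologicalSpace Y] [T2Space Y] [MeasurableSpace Y] [BorelSpace Y]
  {P : Type*} [NormedAddCommGroup P] [NormedSpace ℝ P]
  {V : Type*} [NormedAddCommGroup V] [NormedSpace ℝ V] [FiniteDimensional ℝ V]
  {F : Type*} [NormedAddCommGroup F] [NormedSpace ℝ F] [CompleteSpace F]

/-- **HÖRMANDER'S THEOREM ON A LEAF**: as ★ `contDiffAt_integral_comp_of_contDiff_of_support`, but the uniform vanishing of the integrand off a compact is only asked ON A CLOSED SET `Z`
CARRYING `μ` (`μ Zᶜ = 0`): the integral is the integral over the subtype `Z` against `μ.comap Subtype.val` (finite on compacta), where the engine applies.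
[cite: HormanderALPDO1, Thm. 1.1.9] -/
theorem contDiffAt_integral_comp_of_contDiff_of_support_leaf (μ : Measure Y) [IsFiniteMeasureOnCompacts μ] {Z : Set Y} (hZ : IsClosed Z) (hμZ : μ Zᶜ = 0)
    (Ψ : P × V → F) (hΨ : ContDiff ℝ ∞ Ψ) (y : Y → P) (hy : Continuous y) (X₀ : V) {S : Set Y} (hS : IsCompact S) {U : Set V} (hU : U ∈ 𝓝 X₀)
    (h0 : ∀ t ∈ Z, t ∉ S → ∀ X ∈ U, Ψ (y t, X) = 0) :
    ContDiffAt ℝ ∞ (fun X : V => ∫ t, Ψ (y t, X) ∂μ) X₀ := by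
  have hZm : MeasurableSet Z := hZ.measurableSet
  have hemb : MeasurableEmbedding ((↑) : Z → Y) := MeasurableEmbedding.subtype_coe hZm
  -- the integral lives on the leaf
  have hrestr : μ.restrict Z = μ := Measure.restrict_eq_self_of_ae_mem (ae_iff.2 hμZ)
  have hint : ∀ X, ∫ t, Ψ (y t, X) ∂μ = ∫ t : Z, Ψ (y (t : Y), X) ∂(μ.comap Subtype.val) := fun X => by
    rw [integral_subtype_comap hZm (fun t => Ψ (y t, X)), hrestr]
  simp_rw [hint]
  -- the comap measure is finite on compacta of the leaf
  haveI : IsFiniteMeasureOnCompacts (μ.comap ((↑) : Z → Y)) := ⟨fun K hK => by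
    rw [hemb.comap_apply]
    exact (hK.image continuous_subtype_val).measure_lt_top⟩
  exact Literature.Analysis.Calculus.contDiffAt_integral_comp_of_contDiff_of_support (μ.comap ((↑) : Z → Y)) Ψ hΨ (fun t : Z => y t)
    (hy.comp continuous_subtype_val) X₀ (hZ.isClosedEmbedding_subtypeVal.isCompact_preimage hS) hU
    (fun t ht X hX => h0 t t.2 ht X hX)

end Leaf

/-! ## §2 The leaf integral `I(c) = ∫ fH((z₁,1)·(γ_S(c)·(z₂,1))·(z₁,1)⁻¹) dΛ` is `C^∞` on `InRegS S` -/

section LeafIntegral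

local notation3 "Φ₂[" L "]" => (Matrix.of fun i j : Fin 2 => if i.val + j.val + 1 = 2 then (1 : L) else 0)
local notation3 "Φ₁[" L "]" => (Matrix.of fun i j : Fin 1 => if i.val + j.val + 1 = 1 then (1 : L) else 0)
local notation3 "𝔸[" L "]" => ↥(arch (↥(maximalRealSubfield L)) L (IsCMField.complexConj L) 2 Φ₂[L])
local notation3 "𝔹[" L "]" => ↥(arch (↥(maximalRealSubfield L)) L (IsCMField.complexConj L) 1 Φ₁[L])

variable (L : Type) [Field L] [NumberField L] [IsCMField L] (S : Finset {w : InfinitePlace L // IsComplex w})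
  [MeasurableSpace 𝔸[L]] [BorelSpace 𝔸[L]]

/-- **THE LEAF INTEGRAL IS SMOOTH ON `InRegS S`.**  For `fH ∈ C_c^∞(H_∞)` (★ `ArchSmooth₂`), a measure `Λ` on `A × A` finite on compacta carried by a closed leaf `Z` that is
uniformly proper for `(z, c) ↦ (z₁,1)·(endoTorus S c·(z₂,1))·(z₁,1)⁻¹` over compacts of coordinates regular at the compact places (the PROPER clause of ★
`exists_leafMeasure_archRH_mul_chartOrbH_eq_of_isHaarMeasure`), the function `c ↦ ∫ fH((z₁,1)·(endoTorus L S c·(z₂,1))·(z₁,1)⁻¹) dΛ(z)` is `C^∞` on `InRegS S` — at ALL values of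
the split coordinates `x_w`, `w ∈ S` (Hörmander on the leaf; the integrand reads `Θ(ι(z₁,1)·ι(endoTorus S c)·ι(z₂,1)·ι(z₁,1)⁻¹)` with `c ↦ ι(endoTorus S c)` smooth ★
`contDiff_coe_endoEmbArch_endoTorus`). [cite: Varadarajan1989, §6.4 Thm 23] [cite: HormanderALPDO1, Thm. 1.1.9] [cite: Rogawski1990, §8.2 p. 119] -/
theorem contDiffOn_leafIntegral_inRegS {fH : 𝔸[L] × 𝔹[L] → ℂ} (hfH : ArchSmooth₂ L fH) (Λ : Measure (𝔸[L] × 𝔸[L])) [IsFiniteMeasureOnCompacts Λ]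
    {Z : Set (𝔸[L] × 𝔸[L])} (hZ : IsClosed Z) (hΛZ : Λ Zᶜ = 0)
    (hprop : ∀ U : Set ({w : InfinitePlace L // IsComplex w} → Fin 3 → ℝ), IsCompact U → (∀ c ∈ U, ∀ w, w ∉ S → Circle.exp (c w 0) ≠ Circle.exp (c w 2)) →
      ∀ C : Set (𝔸[L] × 𝔹[L]), IsCompact C → ∃ 𝒮 : Set (𝔸[L] × 𝔸[L]), IsCompact 𝒮 ∧
        ∀ z ∈ Z, ∀ c ∈ U, ((z.1, (1 : 𝔹[L])) * (endoTorus L S c * (z.2, (1 : 𝔹[L]))) * (z.1, (1 : 𝔹[L]))⁻¹) ∈ C → z ∈ 𝒮) :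
    ContDiffOn ℝ ∞ (fun c : {w : InfinitePlace L // IsComplex w} → Fin 3 → ℝ =>
      ∫ z, fH ((z.1, (1 : 𝔹[L])) * (endoTorus L S c * (z.2, (1 : 𝔹[L]))) * (z.1, (1 : 𝔹[L]))⁻¹) ∂Λ) (InRegS S) := by
  haveI : BorelSpace (𝔸[L] × 𝔸[L]) := Prod.borelSpace
  obtain ⟨Θ, hΘ, -, hΘf⟩ := hfH.exists_contDiff
  -- the ambient reading `ι : H_∞ → M₃(L ⊗ ℝ)`
  let Ebar : 𝔸[L] × 𝔹[L] → Matrix (Fin 3) (Fin 3) (mixedSpace L) := fun k => (((endoEmbArch L k).val : GL (Fin 3) (mixedSpace L)) : Matrix (Fin 3) (Fin 3) (mixedSpace L))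
  have hEmul : ∀ x y, Ebar (x * y) = Ebar x * Ebar y := fun x y => by
    simp only [Ebar, map_mul, Subgroup.coe_mul, Units.val_mul]
  have hEcont : Continuous Ebar := Units.continuous_val.comp (continuous_subtype_val.comp (continuous_endoEmbArch L))
  -- datum and smooth kernel
  let y : 𝔸[L] × 𝔸[L] → Matrix (Fin 3) (Fin 3) (mixedSpace L) × Matrix (Fin 3) (Fin 3) (mixedSpace L) × Matrix (Fin 3) (Fin 3) (mixedSpace L) :=
    fun z => (Ebar (z.1, 1), Ebar (z.2, 1), Ebar (z.1, 1)⁻¹)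
  have hy : Continuous y :=
    (hEcont.comp (continuous_fst.prodMk continuous_const)).prodMk
      ((hEcont.comp (continuous_snd.prodMk continuous_const)).prodMk (hEcont.comp (continuous_fst.prodMk continuous_const).inv))
  let Ψ : (Matrix (Fin 3) (Fin 3) (mixedSpace L) × Matrix (Fin 3) (Fin 3) (mixedSpace L) × Matrix (Fin 3) (Fin 3) (mixedSpace L)) ×
      ({w : InfinitePlace L // IsComplex w} → Fin 3 → ℝ) → ℂ :=
    fun q => Θ (q.1.1 * (Ebar (endoTorus L S q.2) * q.1.2.1) * q.1.2.2)
  have hΨ : ContDiff ℝ ∞ Ψ := by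
    refine hΘ.comp ?_
    have h1 : ContDiff ℝ ∞ fun q : (Matrix (Fin 3) (Fin 3) (mixedSpace L) × Matrix (Fin 3) (Fin 3) (mixedSpace L) × Matrix (Fin 3) (Fin 3) (mixedSpace L)) ×
        ({w : InfinitePlace L // IsComplex w} → Fin 3 → ℝ) => q.1.1 := contDiff_fst.comp contDiff_fst
    have h2 : ContDiff ℝ ∞ fun q : (Matrix (Fin 3) (Fin 3) (mixedSpace L) × Matrix (Fin 3) (Fin 3) (mixedSpace L) × Matrix (Fin 3) (Fin 3) (mixedSpace L)) ×
        ({w : InfinitePlace L // IsComplex w} → Fin 3 → ℝ) => q.1.2.1 := contDiff_fst.comp (contDiff_snd.comp contDiff_fst)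
    have h3 : ContDiff ℝ ∞ fun q : (Matrix (Fin 3) (Fin 3) (mixedSpace L) × Matrix (Fin 3) (Fin 3) (mixedSpace L) × Matrix (Fin 3) (Fin 3) (mixedSpace L)) ×
        ({w : InfinitePlace L // IsComplex w} → Fin 3 → ℝ) => q.1.2.2 := contDiff_snd.comp (contDiff_snd.comp contDiff_fst)
    have hE : ContDiff ℝ ∞ fun q : (Matrix (Fin 3) (Fin 3) (mixedSpace L) × Matrix (Fin 3) (Fin 3) (mixedSpace L) × Matrix (Fin 3) (Fin 3) (mixedSpace L)) ×
        ({w : InfinitePlace L // IsComplex w} → Fin 3 → ℝ) => Ebar (endoTorus L S q.2) := (contDiff_coe_endoEmbArch_endoTorus L S).comp contDiff_snd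
    exact (h1.mul (hE.mul h2)).mul h3
  -- the factorisation of the integrand
  have hfac : ∀ z c, fH ((z.1, (1 : 𝔹[L])) * (endoTorus L S c * (z.2, (1 : 𝔹[L]))) * (z.1, (1 : 𝔹[L]))⁻¹) = Ψ (y z, c) := by
    intro z c
    rw [hΘf]
    show Θ (Ebar ((z.1, (1 : 𝔹[L])) * (endoTorus L S c * (z.2, (1 : 𝔹[L]))) * (z.1, (1 : 𝔹[L]))⁻¹)) =
      Θ (Ebar (z.1, 1) * (Ebar (endoTorus L S c) * Ebar (z.2, 1)) * Ebar (z.1, 1)⁻¹)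
    rw [hEmul, hEmul, hEmul]
  have hfun : (fun c : {w : InfinitePlace L // IsComplex w} → Fin 3 → ℝ =>
      ∫ z, fH ((z.1, (1 : 𝔹[L])) * (endoTorus L S c * (z.2, (1 : 𝔹[L]))) * (z.1, (1 : 𝔹[L]))⁻¹) ∂Λ) = fun c => ∫ z, Ψ (y z, c) ∂Λ := by
    funext c
    exact integral_congr_ae (Eventually.of_forall fun z => hfac z c)
  rw [hfun]
  -- locally at `c₀ ∈ InRegS S`: a compact neighbourhood inside `InRegS S`, one compact of the leaf
  refine fun c₀ hc₀ => ContDiffAt.contDiffWithinAt ?_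
  obtain ⟨ε, hε, hball⟩ := Metric.isOpen_iff.1 (isOpen_inRegS S) c₀ hc₀
  have hUc : IsCompact (Metric.closedBall c₀ (ε / 2)) := isCompact_closedBall c₀ (ε / 2)
  have hUsub : Metric.closedBall c₀ (ε / 2) ⊆ InRegS S := (Metric.closedBall_subset_ball (half_lt_self hε)).trans hball
  obtain ⟨𝒮, h𝒮, hmem⟩ := hprop (Metric.closedBall c₀ (ε / 2)) hUc (fun c hc w hw => (mem_inRegS_iff S c).1 (hUsub hc) w hw) (tsupport fH)
    hfH.hasCompactSupport
  refine contDiffAt_integral_comp_of_contDiff_of_support_leaf Λ hZ hΛZ Ψ hΨ y hy c₀ h𝒮 (Metric.closedBall_mem_nhds c₀ (half_pos hε)) fun z hz hzS c hc => ?_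
  rw [← hfac]
  by_contra hne
  exact hzS (hmem z hz c hc (subset_tsupport _ hne))

end LeafIntegral

/-! ## §3 Coordinate factors: the split and compact parts of `R_S` and of `E_S` -/

section Factors

variable {W : Type*} [Fintype W] [DecidableEq W]

/-- **`R_S = R_S^{split} · R_S^{cpt}`**: `archRH S c = (Π_{w∈S} |e^{x_w} − e^{−x_w}|) · Π_{w∉S} (1 − e^{i(c_w2 − c_w0)})`. [cite: Shelstad1979, §4 p. 22] -/
theorem archRH_eq_splitFactor_mul_cptFactor (S : Finset W) (c : W → Fin 3 → ℝ) :
    archRH S c = (∏ w, (if w ∈ S then ((|Real.exp (c w 0) - Real.exp (-c w 0)| : ℝ) : ℂ) else 1)) *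
      ∏ w, (if w ∈ S then (1 : ℂ) else 1 - (Circle.exp (c w 2 - c w 0) : ℂ)) := by
  unfold archRH
  rw [← Finset.prod_mul_distrib]
  refine Finset.prod_congr rfl fun w _ => ?_
  by_cases hw : w ∈ S
  · simp only [if_pos hw, mul_one]
  · simp only [if_neg hw, one_mul]

/-- **`E_S = E_S^{split} · R_S^{cpt}`**: `Π_w [w ∈ S ? e^{x_w} : 1 − e^{i(c_w2−c_w0)}] = (Π_{w∈S} e^{x_w}) · Π_{w∉S} (1 − e^{i(c_w2 − c_w0)})`. [cite: Shelstad1979, §4 p. 22] -/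
theorem expFactor_eq_splitFactor_mul_cptFactor (S : Finset W) (c : W → Fin 3 → ℝ) :
    (∏ w, (if w ∈ S then ((Real.exp (c w 0) : ℝ) : ℂ) else 1 - (Circle.exp (c w 2 - c w 0) : ℂ))) =
      (∏ w, (if w ∈ S then ((Real.exp (c w 0) : ℝ) : ℂ) else 1)) * ∏ w, (if w ∈ S then (1 : ℂ) else 1 - (Circle.exp (c w 2 - c w 0) : ℂ)) := by
  rw [← Finset.prod_mul_distrib]
  refine Finset.prod_congr rfl fun w _ => ?_
  by_cases hw : w ∈ S
  · simp only [if_pos hw, mul_one]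
  · simp only [if_neg hw, one_mul]

/-- **The compact-place factor does not vanish on `InRegS S`** (`1 − e^{i(θ₂−θ₀)} ≠ 0 ⟺ e^{iθ₀} ≠ e^{iθ₂}`, ★ `one_sub_coe_circleExp_sub_ne_zero_iff`).
[cite: Bouaziz1994IntegralesOrbitales, §3.1 p. 579] -/
theorem cptFactor_ne_zero_of_mem_inRegS (S : Finset W) {c : W → Fin 3 → ℝ} (hc : c ∈ InRegS S) :
    (∏ w, (if w ∈ S then (1 : ℂ) else 1 - (Circle.exp (c w 2 - c w 0) : ℂ))) ≠ 0 := by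
  refine Finset.prod_ne_zero_iff.2 fun w _ => ?_
  by_cases hw : w ∈ S
  · rw [if_pos hw]; exact one_ne_zero
  · rw [if_neg hw]; exact (one_sub_coe_circleExp_sub_ne_zero_iff (c w 0) (c w 2)).2 ((mem_inRegS_iff S c).1 hc w hw)

/-- **The split factors do not see the flips of the compact places**: for `T ⊆ Sᶜ`, `Π_{w∈S} φ(x_w(flipSet T c)) = Π_{w∈S} φ(x_w(c))`. [cite: Shelstad1979, §4 p. 23] -/
theorem splitFactor_flipSet (S : Finset W) {T : Finset W} (hT : ∀ w ∈ T, w ∉ S) (φ : ℝ → ℂ) (c : W → Fin 3 → ℝ) :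
    (∏ w, (if w ∈ S then φ (flipSet T c w 0) else 1)) = ∏ w, (if w ∈ S then φ (c w 0) else 1) := by
  refine Finset.prod_congr rfl fun w _ => ?_
  by_cases hw : w ∈ S
  · rw [if_pos hw, if_pos hw, flipSet_apply_of_not_mem (fun hwT => hT w hwT hw)]
  · rw [if_neg hw, if_neg hw]

/-- `E_S` is smooth in the coordinates (exponentials). [cite: Shelstad1979, §4 p. 22] -/
theorem contDiff_expFactor (S : Finset W) :
    ContDiff ℝ ∞ fun c : W → Fin 3 → ℝ => ∏ w, (if w ∈ S then ((Real.exp (c w 0) : ℝ) : ℂ) else 1 - (Circle.exp (c w 2 - c w 0) : ℂ)) := by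
  refine contDiff_prod fun w _ => ?_
  by_cases hw : w ∈ S
  · simp only [if_pos hw]
    exact ofRealCLM.contDiff.comp (Real.contDiff_exp.comp (contDiff_apply_apply ℝ ℝ w 0))
  · simp only [if_neg hw]
    have he : ContDiff ℝ ∞ fun c : W → Fin 3 → ℝ => (Circle.exp (c w 2 - c w 0) : ℂ) := by
      have h : (fun c : W → Fin 3 → ℝ => (Circle.exp (c w 2 - c w 0) : ℂ)) = fun c => Complex.exp (((c w 2 - c w 0 : ℝ) : ℂ) * I) :=
        funext fun c => Circle.coe_exp _
      rw [h]
      exact Complex.contDiff_exp.comp ((ofRealCLM.contDiff.comp ((contDiff_apply_apply ℝ ℝ w 2).sub (contDiff_apply_apply ℝ ℝ w 0))).mul contDiff_const)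
    exact contDiff_const.sub he

end Factors

/-! ## §4 The head: `stOrbFamH L νH fH S` is `C^∞` on the fundamental slab, through the split walls -/

section Head

local notation3 "Φ₂[" L "]" => (Matrix.of fun i j : Fin 2 => if i.val + j.val + 1 = 2 then (1 : L) else 0)
local notation3 "Φ₁[" L "]" => (Matrix.of fun i j : Fin 1 => if i.val + j.val + 1 = 1 then (1 : L) else 0)
local notation3 "𝔸[" L "]" => ↥(arch (↥(maximalRealSubfield L)) L (IsCMField.complexConj L) 2 Φ₂[L])
local notation3 "𝔹[" L "]" => ↥(arch (↥(maximalRealSubfield L)) L (IsCMField.complexConj L) 1 Φ₁[L])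

variable (L : Type) [Field L] [NumberField L] [IsCMField L]
  [iH : MeasurableSpace (𝔸[L] × 𝔹[L])] [BorelSpace (𝔸[L] × 𝔹[L])]
  (νH : Measure (𝔸[L] × 𝔹[L])) [νH.IsHaarMeasure] [νH.IsMulRightInvariant]

/-- **[C1b] ON THE IN-REGULAR SET**: for `fH ∈ C_c^∞(H_∞)` (★ `ArchSmooth₂`) and a Haar measure `νH`, the normalised stable orbital family `stOrbFamH L νH fH S` is `C^∞` on Bouaziz's
`InRegS S` (compact places regular, ALL split coordinates — through the real walls `x_w = 0`): on `RegS S` it is `G = K₀ · E_S · Σ_T I ∘ flipSet T` (★ (M1b′) + ★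
`stOrbFamH_of_mem_regS`, the compact factors cancelling), `G` is `C^∞` on `InRegS S` (§2), and at the real walls the family IS the limit of `G` (★ `stOrbFamH_eq_of_tendsto`, ★
`mem_closure_regS`).  Harish-Chandra: `F_f^A ∈ C^∞(A)`. [cite: Varadarajan1989, §6.4 Thm 23] [cite: Shelstad1979, §4 Lemma 4.3 p. 25] [cite: Bouaziz1994IntegralesOrbitales, §3.1 (I₁) p. 579]
[cite: Rogawski1990, §8.2 p. 119] -/
theorem contDiffOn_stOrbFamH_inRegS {fH : 𝔸[L] × 𝔹[L] → ℂ} (hfH : ArchSmooth₂ L fH) (S : Finset {w : InfinitePlace L // IsComplex w}) :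
    ContDiffOn ℝ ∞ (stOrbFamH L νH fH S) (InRegS S) := by
  -- pass to the Borel structures of the factors (the product of the Borel σ-algebras is the Borel σ-algebra: second countability)
  letI mA : MeasurableSpace 𝔸[L] := borel _
  haveI : BorelSpace 𝔸[L] := ⟨rfl⟩
  letI mB : MeasurableSpace 𝔹[L] := borel _
  haveI : BorelSpace 𝔹[L] := ⟨rfl⟩
  have hiH : iH = Prod.instMeasurableSpace :=
    (‹BorelSpace (𝔸[L] × 𝔹[L])›.measurable_eq).trans (Prod.borelSpace (α := 𝔸[L]) (β := 𝔹[L])).measurable_eq.symm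
  subst hiH
  -- (M1b′): the uniform unfolding and its leaf
  obtain ⟨K₀, Λ, Z, hΛ, hZ, hΛZ, hprop, hid⟩ := exists_leafMeasure_archRH_mul_chartOrbH_eq_of_isHaarMeasure L S νH fH hfH.continuous
  haveI := hΛ
  -- the smooth model `G = K₀ · E_S · Σ_T I ∘ flipSet T`
  set I : ({w : InfinitePlace L // IsComplex w} → Fin 3 → ℝ) → ℂ :=
    fun c => ∫ z, fH ((z.1, (1 : 𝔹[L])) * (endoTorus L S c * (z.2, (1 : 𝔹[L]))) * (z.1, (1 : 𝔹[L]))⁻¹) ∂Λ with hIdef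
  have hI : ContDiffOn ℝ ∞ I (InRegS S) := contDiffOn_leafIntegral_inRegS L S hfH Λ hZ hΛZ hprop
  set G : ({w : InfinitePlace L // IsComplex w} → Fin 3 → ℝ) → ℂ := fun c =>
    (K₀ : ℂ) * (∏ w, (if w ∈ S then ((Real.exp (c w 0) : ℝ) : ℂ) else 1 - (Circle.exp (c w 2 - c w 0) : ℂ))) *
      ∑ T ∈ (Finset.univ \ S).powerset, I (flipSet T c) with hGdef
  have hG : ContDiffOn ℝ ∞ G (InRegS S) := by
    refine (contDiffOn_const.mul (contDiff_expFactor S).contDiffOn).mul (ContDiffOn.sum fun T hT => ?_)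
    exact hI.comp (contDiff_flipSet T).contDiffOn fun c hc => (flipSet_mem_inRegS_iff S T c).2 hc
  -- (M3) on `RegS S` the family IS `G`
  have hreg : ∀ c ∈ RegS S, stOrbFamH L νH fH S c = G c := by
    intro c hc
    have hcI : c ∈ InRegS S := regS_subset_inRegS S hc
    rw [stOrbFamH_of_mem_regS L νH fH S hc, hGdef]
    simp only
    rw [Finset.mul_sum, Finset.mul_sum]
    refine Finset.sum_congr rfl fun T hT => ?_
    have hTS : ∀ w ∈ T, w ∉ S := not_mem_of_mem_powerset_sdiff hT
    have hcT : flipSet T c ∈ RegS S := (flipSet_mem_regS_iff S hTS c).2 hc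
    have hcTI : flipSet T c ∈ InRegS S := regS_subset_inRegS S hcT
    have h := hid (flipSet T c) hcT
    rw [archRH_eq_splitFactor_mul_cptFactor, expFactor_eq_splitFactor_mul_cptFactor,
      splitFactor_flipSet S hTS (fun x => ((|Real.exp x - Real.exp (-x)| : ℝ) : ℂ)), splitFactor_flipSet S hTS (fun x => ((Real.exp x : ℝ) : ℂ))] at h
    have hne := cptFactor_ne_zero_of_mem_inRegS S hcTI
    -- cancel the compact factor at `flipSet T c`
    have h' : (∏ w, (if w ∈ S then ((|Real.exp (c w 0) - Real.exp (-c w 0)| : ℝ) : ℂ) else 1)) * chartOrbH L νH S fH (flipSet T c) =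
        (K₀ : ℂ) * (∏ w, (if w ∈ S then ((Real.exp (c w 0) : ℝ) : ℂ) else 1)) * I (flipSet T c) := by
      have h2 : (∏ w, (if w ∈ S then (1 : ℂ) else 1 - (Circle.exp (flipSet T c w 2 - flipSet T c w 0) : ℂ))) *
          ((∏ w, (if w ∈ S then ((|Real.exp (c w 0) - Real.exp (-c w 0)| : ℝ) : ℂ) else 1)) * chartOrbH L νH S fH (flipSet T c)) =
          (∏ w, (if w ∈ S then (1 : ℂ) else 1 - (Circle.exp (flipSet T c w 2 - flipSet T c w 0) : ℂ))) *
          ((K₀ : ℂ) * (∏ w, (if w ∈ S then ((Real.exp (c w 0) : ℝ) : ℂ) else 1)) * I (flipSet T c)) := by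
        rw [hIdef]
        calc _ = (∏ w, (if w ∈ S then ((|Real.exp (c w 0) - Real.exp (-c w 0)| : ℝ) : ℂ) else 1)) *
              (∏ w, (if w ∈ S then (1 : ℂ) else 1 - (Circle.exp (flipSet T c w 2 - flipSet T c w 0) : ℂ))) * chartOrbH L νH S fH (flipSet T c) := by ring
          _ = _ := by rw [h]; ring
      exact mul_left_cancel₀ hne h2
    rw [archRH_eq_splitFactor_mul_cptFactor, expFactor_eq_splitFactor_mul_cptFactor]
    calc (∏ w, (if w ∈ S then ((|Real.exp (c w 0) - Real.exp (-c w 0)| : ℝ) : ℂ) else 1)) *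
          (∏ w, (if w ∈ S then (1 : ℂ) else 1 - (Circle.exp (c w 2 - c w 0) : ℂ))) * chartOrbH L νH S fH (flipSet T c)
        = (∏ w, (if w ∈ S then (1 : ℂ) else 1 - (Circle.exp (c w 2 - c w 0) : ℂ))) *
          ((∏ w, (if w ∈ S then ((|Real.exp (c w 0) - Real.exp (-c w 0)| : ℝ) : ℂ) else 1)) * chartOrbH L νH S fH (flipSet T c)) := by ring
      _ = _ := by rw [h']; ring
  -- (M4) at the real walls the family is the limit of `G` from `RegS S`
  have hall : ∀ c ∈ InRegS S, stOrbFamH L νH fH S c = G c := by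
    intro c hc
    by_cases hcR : c ∈ RegS S
    · exact hreg c hcR
    · refine stOrbFamH_eq_of_tendsto L νH fH S hc hcR (mem_closure_regS S c) ?_
      have hcont : ContinuousAt G c := (hG.continuousOn.continuousWithinAt hc).continuousAt ((isOpen_inRegS S).mem_nhds hc)
      refine (hcont.tendsto.mono_left nhdsWithin_le_nhds).congr' ?_
      filter_upwards [self_mem_nhdsWithin] with c' hc'
      rw [← hreg c' hc', stOrbFamH_of_mem_regS L νH fH S hc', stableSum_def]
  exact hG.congr hall

/-- **[C1b] — THE `h1` OF ★ `archBzSmoothBounded_stOrbFamH_of_slab_zero`**: for every `fH ∈ C_c^∞(H_∞)` (★ `ArchSmooth₂`), every Haar measure `νH` on `H_∞` and every Cartan label `S`,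
the normalised stable orbital family `stOrbFamH L νH fH S` is `C^∞` on the fundamental slab `{0 < c w 0 − c w 2 < 2π, w ∉ S}` — in particular ACROSS THE SPLIT WALLS `x_w = 0`, `w ∈ S`
(Harish-Chandra: `F_f^A` is smooth on all of `A`; the slab lies in `InRegS S`, ★ `mem_inRegS_of_mem_slab`). [cite: Varadarajan1989, §6.4 Thm 23] [cite: Shelstad1979, §4 Lemma 4.3 p. 25]
[cite: Bouaziz1994IntegralesOrbitales, §3.1 (I₁) p. 579; §6.2 p. 591] [cite: Rogawski1990, §8.2 p. 119] -/
theorem contDiffOn_stOrbFamH_slab_zero {fH : 𝔸[L] × 𝔹[L] → ℂ} (hfH : ArchSmooth₂ L fH) (S : Finset {w : InfinitePlace L // IsComplex w}) :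
    ContDiffOn ℝ ∞ (stOrbFamH L νH fH S) {c | ∀ w, w ∉ S → 0 < c w 0 - c w 2 ∧ c w 0 - c w 2 < 2 * Real.pi} := by
  refine (contDiffOn_stOrbFamH_inRegS L νH hfH S).mono fun c hc => mem_inRegS_of_mem_slab S 0 fun w hw => ?_
  have h := hc w hw
  simp only [Pi.zero_apply, Int.cast_zero, mul_zero, zero_add, mul_one]
  exact h

end Head

end Literature.NumberTheory.Rogawski1990

end
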